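import Summits.QuantumFields.GaugeBoot.ClassBLimitSymmetry
import Literature.MathematicalPhysics.QuantumFieldTheory.ConstructiveQFTWave0OddRPProofs
import Literature.MathematicalPhysics.QuantumFieldTheory.Balaban1983to89.InfiniteVolumeSufficientIV
import HarnessLib

/-!
# Link reflections of `ℤ^d` versus the torus; lifting half-space observables (gauge-boot, Class-B brick)

HONEST FRAMING (cell `pub-gaugeboot`, page 1 of every file): the venture produces certified bounds
on lattice expectations at stated coupling, gauge group, dimension and torus size; NOT a mass gap,
NOT a continuum limit, NOT a string tension; NOT Yang–Mills-summit-bearing (barriers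
`FixedCouplingUltralocality`, `PerturbativeInvisibility`).

Geometric preliminaries for the link reflection positivity of torus limit points
(`ClassBLimitLinkRP.lean`):

* `configLinkReflect_zero_eq` — `ClassB.lean`'s link reflection `configLinkReflect 0` (mirror
  `x_0 = ½`) is the site reflection `configSiteReflect 0` after the unit translation
  `configShift (-e_0)`; continuity, measurability, cylinder preservation;
* `torusLift_timeReflect` — the periodic lift intertwines `configLinkReflect 0` with Wave 0's torus
  reflection `GaugeConfig.timeReflect` (`t ↦ 1 - t`);
* `isPositiveTimeObservable_toTorusObservable` / `dependsOn_toTorusObservable_oPos` — a cylinder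
  observable supported on links with `1 ≤ x_0 ≤ m` lifts, for `m + 1 ≤ L/2`, to a positive-time
  observable of the torus `(ℤ/L)^d` in Wave 0's even-torus sense (`1 ≤ t ≤ L/2`, both endpoints)
  and in the odd-torus sense (`oPosEdges`, `1 ≤ t ≤ L/2`);
* `isCylinder_filter_of_dependsOn` — a cylinder observable depending on a half-space depends on
  the cylinder's links inside the half-space.

References: K. Osterwalder, E. Seiler, Ann. Phys. 110 (1978) 440, §2; E. Seiler, LNP 159 (1982)
Thm. 2.2; J. Glimm, A. Jaffe, Quantum Physics (1987) §6.1.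
-/

noncomputable section

open MeasureTheory Filter Topology
open scoped ComplexOrder ComplexConjugate
open Literature.Probability.LatticeModels (Site Torus.proj)
open Literature.MathematicalPhysics.QuantumLattice
open Literature.MathematicalPhysics.QuantumFieldTheory (GaugeConfig Edge wilsonExpectation
  wilsonMeasure isProbabilityMeasure_wilsonMeasure measurable_torusLift
  wilsonExpectation_reflectionPositive_holds wilsonExpectation_oddReflectionPositive
  IsPositiveTimeObservable)

namespace Summit.QuantumFields.GaugeBoot

variable {d N : ℕ} {G : Type*} [Group G] [TopologicalSpace G] [IsTopologicalGroup G]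
  [CompactSpace G] [MeasurableSpace G] [BorelSpace G]
variable (ρ : G →* Matrix (Fin N) (Fin N) ℂ)

/-! ## The link reflection on `ℤ^d` and on the torus -/

section LinkMaps

omit [TopologicalSpace G] [IsTopologicalGroup G] [CompactSpace G] [MeasurableSpace G] [BorelSpace G] in
/-- `configLinkReflect` unfolded. -/
theorem configLinkReflect_apply (i : Fin d) (U : LGConfig d G) (e : ZdEdge d) :
    configLinkReflect i U e = if e.2 = i then (U (zdLinkReflect i e.1 - Pi.single i 1, i))⁻¹
      else U (zdLinkReflect i e.1, e.2) := rfl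

omit [TopologicalSpace G] [IsTopologicalGroup G] [CompactSpace G] [BorelSpace G] in
/-- **The link reflection is the site reflection followed by the unit translation**:
`configLinkReflect 0 = configSiteReflect 0 ∘ configShift (-e_0)`. -/
theorem configLinkReflect_zero_eq [NeZero d] (U : LGConfig d G) :
    configLinkReflect 0 U = configSiteReflect 0 (configShift (-Pi.single 0 1) U) := by
  funext e
  obtain ⟨x, k⟩ := e
  rw [configLinkReflect_apply, configSiteReflect_apply]
  have hx : (zdSiteReflect 0 x : Site d) - -Pi.single 0 1 = zdLinkReflect 0 x := by
    funext m
    by_cases hm : m = 0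
    · subst hm; simp [zdSiteReflect, zdLinkReflect]; ring
    · simp [zdSiteReflect, zdLinkReflect, hm]
  have hx' : (zdSiteReflect 0 x - Pi.single 0 1 : Site d) - -Pi.single 0 1 =
      zdLinkReflect 0 x - Pi.single 0 1 := by
    rw [← hx]; abel
  by_cases hk : k = 0
  · rw [if_pos hk, if_pos hk, configShift_apply, hx']
  · rw [if_neg hk, if_neg hk, configShift_apply, hx]

omit [CompactSpace G] [MeasurableSpace G] [BorelSpace G] in
/-- The link reflection of configurations is continuous. -/
theorem continuous_configLinkReflect (i : Fin d) :
    Continuous (configLinkReflect (G := G) i : LGConfig d G → LGConfig d G) := by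
  refine continuous_pi fun e => ?_
  by_cases he : e.2 = i
  · simp only [configLinkReflect, he, ↓reduceIte]
    exact (continuous_apply _).inv
  · simp only [configLinkReflect, he, ↓reduceIte]
    exact continuous_apply _

omit [CompactSpace G] in
/-- The link reflection of configurations is measurable. -/
theorem measurable_configLinkReflect [SecondCountableTopology G] (i : Fin d) :
    Measurable (configLinkReflect (G := G) i : LGConfig d G → LGConfig d G) := by
  refine measurable_pi_lambda _ fun e => ?_
  by_cases he : e.2 = i
  · simp only [configLinkReflect, he, ↓reduceIte]
    exact (measurable_pi_apply _).inv
  · simp only [configLinkReflect, he, ↓reduceIte]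
    exact measurable_pi_apply _

omit [TopologicalSpace G] [IsTopologicalGroup G] [CompactSpace G] [MeasurableSpace G] [BorelSpace G] in
/-- A cylinder observable stays a cylinder observable under a link reflection. -/
theorem isCylinder_comp_configLinkReflect {α : Type*} {F : LGConfig d G → α} {S : Finset (ZdEdge d)}
    (hF : IsCylinder F S) (i : Fin d) :
    IsCylinder (F ∘ configLinkReflect i)
      (S.image fun e => if e.2 = i then (zdLinkReflect i e.1 - Pi.single i 1, i)
        else (zdLinkReflect i e.1, e.2)) := by
  intro U V hUV
  apply hF
  intro e he
  have h := hUV _ (Finset.mem_coe.2 (Finset.mem_image_of_mem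
    (fun e : ZdEdge d => if e.2 = i then (zdLinkReflect i e.1 - Pi.single i 1, i)
      else (zdLinkReflect i e.1, e.2)) (Finset.mem_coe.1 he)))
  simp only [configLinkReflect_apply]
  by_cases he2 : e.2 = i
  · rw [if_pos he2] at h; rw [if_pos he2, if_pos he2, h]
  · rw [if_neg he2] at h; rw [if_neg he2, if_neg he2, h]

variable [NeZero d]

omit [TopologicalSpace G] [IsTopologicalGroup G] [CompactSpace G] [MeasurableSpace G] [BorelSpace G] in
/-- The torus projection intertwines the link reflections of `ℤ^d` and of the torus (axis `0`). -/
theorem torusProj_zdLinkReflect (L : ℕ) (x : Site d) :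
    Torus.proj L (zdLinkReflect 0 x) =
      Literature.MathematicalPhysics.QuantumFieldTheory.Site.timeReflect (Torus.proj L x) := by
  funext k
  by_cases hk : k = 0
  · subst hk
    simp [Torus.proj, zdLinkReflect, Literature.MathematicalPhysics.QuantumFieldTheory.Site.timeReflect]
  · simp [Torus.proj, zdLinkReflect, Literature.MathematicalPhysics.QuantumFieldTheory.Site.timeReflect, hk]

omit [TopologicalSpace G] [IsTopologicalGroup G] [CompactSpace G] [MeasurableSpace G] [BorelSpace G] in
/-- The same for the base point of a reflected direction-`0` link. -/
theorem torusProj_zdLinkReflect_sub (L : ℕ) (x : Site d) :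
    Torus.proj L (zdLinkReflect 0 x - Pi.single 0 1) =
      Literature.MathematicalPhysics.QuantumFieldTheory.Site.timeReflect
        (Literature.MathematicalPhysics.QuantumFieldTheory.Site.shift (Torus.proj L x) 0) := by
  funext k
  by_cases hk : k = 0
  · subst hk
    simp [Torus.proj, zdLinkReflect, Literature.MathematicalPhysics.QuantumFieldTheory.Site.timeReflect,
      Literature.MathematicalPhysics.QuantumFieldTheory.Site.shift]
  · simp [Torus.proj, zdLinkReflect, Literature.MathematicalPhysics.QuantumFieldTheory.Site.timeReflect,
      Literature.MathematicalPhysics.QuantumFieldTheory.Site.shift, hk]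

omit [TopologicalSpace G] [IsTopologicalGroup G] [CompactSpace G] [MeasurableSpace G] [BorelSpace G] in
/-- **The periodic lift intertwines the link reflections**:
`torusLift L (timeReflect U) = configLinkReflect 0 (torusLift L U)`. -/
theorem torusLift_timeReflect (L : ℕ) (U : GaugeConfig d L G) :
    torusLift L U.timeReflect = configLinkReflect 0 (torusLift L U) := by
  funext e
  obtain ⟨x, k⟩ := e
  rw [configLinkReflect_apply]
  simp only [torusLift, Function.comp_apply, torusEdge,
    Literature.MathematicalPhysics.QuantumFieldTheory.GaugeConfig.timeReflect]
  by_cases hk : k = 0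
  · subst hk
    simp [torusProj_zdLinkReflect_sub]
  · simp [hk, torusProj_zdLinkReflect]

omit [TopologicalSpace G] [IsTopologicalGroup G] [CompactSpace G] [MeasurableSpace G] [BorelSpace G] in
/-- Observable form of `torusLift_timeReflect`. -/
theorem toTorusObservable_comp_configLinkReflect_zero {α : Type*} (L : ℕ) (F : LGConfig d G → α) :
    toTorusObservable L (F ∘ configLinkReflect 0) =
      toTorusObservable L F ∘ Literature.MathematicalPhysics.QuantumFieldTheory.GaugeConfig.timeReflect := by
  funext U
  simp only [toTorusObservable, Function.comp_apply, torusLift_timeReflect]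

end LinkMaps

/-! ## Lifting a finitely supported half-space observable to a large torus -/

section Support

variable [NeZero d]

omit [Group G] [TopologicalSpace G] [IsTopologicalGroup G] [CompactSpace G] [MeasurableSpace G]
  [BorelSpace G] in
/-- The time coordinate of the torus projection of a site with `0 ≤ x_0 < L`. -/
theorem val_torusProj_zero {L : ℕ} [NeZero L] {x : Site d} (h0 : 0 ≤ x 0) (hL : x 0 < L) :
    (((Torus.proj L x) 0).val : ℤ) = x 0 := by
  simp only [Torus.proj]
  rw [ZMod.val_intCast, Int.emod_eq_of_lt h0 hL]

omit [Group G] [TopologicalSpace G] [IsTopologicalGroup G] [CompactSpace G] [MeasurableSpace G]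
  [BorelSpace G] in
/-- The time coordinate of the endpoint of the lifted link. -/
theorem val_torusProj_shift_zero {L : ℕ} [NeZero L] {x : Site d} (k : Fin d) (h0 : 0 ≤ x 0)
    (hL : x 0 + 1 < L) :
    ((Literature.MathematicalPhysics.QuantumFieldTheory.Site.shift (Torus.proj L x) k 0).val : ℤ) =
      x 0 + if k = 0 then 1 else 0 := by
  have hk0 : (x + Pi.single k (1 : ℤ) : Site d) 0 = x 0 + (if k = 0 then 1 else 0) := by
    rw [Pi.add_apply]
    by_cases hk : k = 0
    · subst hk; simp
    · rw [Pi.single_eq_of_ne (Ne.symm hk), if_neg hk]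
  have h := val_torusProj_zero (d := d) (L := L) (x := x + Pi.single k 1)
    (by rw [hk0]; split_ifs <;> omega) (by rw [hk0]; split_ifs <;> omega)
  have hs : Literature.MathematicalPhysics.QuantumFieldTheory.Site.shift (Torus.proj L x) k =
      Torus.proj L (x + Pi.single k 1) := by
    funext m
    simp only [Literature.MathematicalPhysics.QuantumFieldTheory.Site.shift, Torus.proj, Pi.add_apply]
    by_cases hm : m = k
    · subst hm
      rw [Pi.single_eq_same, Pi.single_eq_same]; push_cast; ring
    · rw [Pi.single_eq_of_ne hm, Pi.single_eq_of_ne hm]; push_cast; ring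
  rw [hs, h, hk0]

omit [Group G] [TopologicalSpace G] [IsTopologicalGroup G] [CompactSpace G] [MeasurableSpace G]
  [BorelSpace G] in
/-- **A half-space cylinder observable lifts to a positive-time torus observable** (even torus,
Wave 0's half `1 ≤ t ≤ L/2`): if `F` depends only on links `T` with `1 ≤ x_0 ≤ m` and
`m + 1 ≤ L/2`, then `F ∘ torusLift L` is a positive-time observable. -/
theorem isPositiveTimeObservable_toTorusObservable {L : ℕ} [NeZero L] {α : Type*}
    {F : LGConfig d G → α} {T : Finset (ZdEdge d)} (hF : IsCylinder F T) {m : ℕ}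
    (hT1 : ∀ e ∈ T, 1 ≤ e.1 0) (hTm : ∀ e ∈ T, e.1 0 ≤ m) (hmL : m + 1 ≤ L / 2) :
    IsPositiveTimeObservable (toTorusObservable L F) := by
  intro U V hUV
  apply hF
  intro e he
  have he' := Finset.mem_coe.1 he
  have h1 := hT1 e he'
  have hm := hTm e he'
  have hL2 : (L / 2 : ℕ) ≤ L := Nat.div_le_self L 2
  have hv := val_torusProj_zero (d := d) (L := L) (x := e.1) (by omega) (by omega)
  have hs := val_torusProj_shift_zero (d := d) (L := L) (x := e.1) e.2 (by omega) (by omega)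
  simp only [torusLift, Function.comp_apply, torusEdge]
  refine hUV _ ?_ ?_ ?_ ?_
  · have : (1 : ℤ) ≤ ((Torus.proj L e.1 0).val : ℤ) := by rw [hv]; exact h1
    exact_mod_cast this
  · have : (((Torus.proj L e.1) 0).val : ℤ) ≤ (L / 2 : ℕ) := by rw [hv]; omega
    exact_mod_cast this
  · have : (1 : ℤ) ≤ ((Literature.MathematicalPhysics.QuantumFieldTheory.Site.shift
        (Torus.proj L e.1) e.2 0).val : ℤ) := by rw [hs]; split_ifs <;> omega
    exact_mod_cast this
  · have : ((Literature.MathematicalPhysics.QuantumFieldTheory.Site.shift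
        (Torus.proj L e.1) e.2 0).val : ℤ) ≤ (L / 2 : ℕ) := by rw [hs]; split_ifs <;> omega
    exact_mod_cast this

omit [Group G] [TopologicalSpace G] [IsTopologicalGroup G] [CompactSpace G] [MeasurableSpace G]
  [BorelSpace G] in
/-- The odd-torus variant: the lifted observable depends only on Wave 0's odd positive half
`oPosEdges ∪ oSharedEdges` (`1 ≤ t ≤ (L+1)/2`). -/
theorem dependsOn_toTorusObservable_oPos {L : ℕ} [NeZero L] {α : Type*}
    {F : LGConfig d G → α} {T : Finset (ZdEdge d)} (hF : IsCylinder F T) {m : ℕ}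
    (hT1 : ∀ e ∈ T, 1 ≤ e.1 0) (hTm : ∀ e ∈ T, e.1 0 ≤ m) (hmL : m + 1 ≤ L / 2) :
    DependsOn (toTorusObservable L F)
      ((Literature.MathematicalPhysics.QuantumFieldTheory.WilsonOddRP.oPosEdges ∪
        Literature.MathematicalPhysics.QuantumFieldTheory.WilsonOddRP.oSharedEdges :
          Finset (Edge d L)) : Set (Edge d L)) := by
  intro U V hUV
  apply hF
  intro e he
  have he' := Finset.mem_coe.1 he
  have h1 := hT1 e he'
  have hm := hTm e he'
  have hL2 : (L / 2 : ℕ) ≤ L := Nat.div_le_self L 2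
  have hv := val_torusProj_zero (d := d) (L := L) (x := e.1) (by omega) (by omega)
  simp only [torusLift, Function.comp_apply, torusEdge]
  refine hUV _ ?_
  rw [Finset.coe_union, Set.mem_union]
  left
  rw [Finset.mem_coe, Literature.MathematicalPhysics.QuantumFieldTheory.WilsonOddRP.mem_oPosEdges]
  constructor
  · have : (1 : ℤ) ≤ ((Torus.proj L e.1 0).val : ℤ) := by rw [hv]; exact h1
    exact_mod_cast this
  · have : (((Torus.proj L e.1) 0).val : ℤ) ≤ (L / 2 : ℕ) := by rw [hv]; omega
    exact_mod_cast this

omit [Group G] [TopologicalSpace G] [IsTopologicalGroup G] [CompactSpace G] [MeasurableSpace G]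
  [BorelSpace G] [NeZero d] in
/-- A cylinder observable depending on a half-space depends on the cylinder's links in the
half-space. -/
theorem isCylinder_filter_of_dependsOn {α : Type*} {F : LGConfig d G → α} {T : Finset (ZdEdge d)}
    (hF : IsCylinder F T) {S : Set (ZdEdge d)} [DecidablePred (· ∈ S)] (hFS : DependsOn F S) :
    IsCylinder F (T.filter (· ∈ S)) := by
  intro U V hUV
  let W : LGConfig d G := fun e => if e ∈ S then U e else V e
  have hU : F W = F U := hFS fun e he => by simp [W, he]
  have hV : F W = F V := hF fun e he => by
    by_cases hes : e ∈ S
    · simp only [W, hes, ↓reduceIte]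
      exact hUV e (Finset.mem_coe.2 (Finset.mem_filter.2 ⟨Finset.mem_coe.1 he, hes⟩))
    · simp [W, hes]
  rw [← hU, hV]

end Support

end Summit.QuantumFields.GaugeBoot
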